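import Literature.Combinatorics.StablePolynomials.MasterCompositionDisk
import Literature.Combinatorics.StablePolynomials.SymmetrizationClosedDomains
import HarnessLib

/-!
# Multivariate apolarity for the disc (Borcea–Brändén II, §5: the form `{f,g}_κ` and Lemma 5.5)

J. Borcea, P. Brändén, *The Lee–Yang and Pólya–Schur programs. II. Theory of stable polynomials and
applications*, Comm. Pure Appl. Math. 62 (2009) 1595–1631 (arXiv:0809.3087), §5:

> For two polynomials `f, g ∈ ℂ[z_1,…,z_n]` and `κ ∈ ℕⁿ` define
> `{f,g}_κ := Σ_{α ≤ κ} (-1)^α f^{(α)}(0) g^{(κ-α)}(0)`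
> and call `f` and `g` apolar if they both have degree at most `κ` and `{f,g}_κ = 0`.
>
> **Lemma 5.5.** Let `f, g ∈ ℂ[z_1,…,z_n]` and suppose that `g` has degree `κ ∈ ℕⁿ`. If `f` is `𝔻`-stable
> and `g` is `ℂ ∖ 𝔻`-stable then `{f,g}_κ ≠ 0`.

(The printed sign `(-1)^κ` in the display is a misprint for `(-1)^α = (-1)^{|α|}`, as the proof — "`{f,g}_κ =
κ! F((1+δ)^{-1/2},…,(1+δ)^{-1/2})`" with `F(z,w) = Σ_α (-1)^α a_α b_{κ-α} (1+δ)^{|α|} binom(κ,α)^{-1} z^α w^α`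
— and the univariate form `{f,g}_n = Σ_k (-1)^k f^{(k)}(0) g^{(n-k)}(0)` show.) Lemma 5.5 is Theorem 5.6 for
`C_1 = ⋯ = C_n = 𝔻`.

The proof is the printed one: `h(z) = Σ_α (-1)^α b_{κ-α} z^α` is `𝔻̄`-stable by Corollary 1.7 (closed version,
`DiskInversionClosed.lean`); by compactness (`exists_gt_radius_of_closedPolydisc`) `h((1+δ)z)` is `𝔻`-stable
for some `δ > 0`; the master composition theorem for the disc (Corollary 3.4 (c), `MasterCompositionDisk.lean`)
applied to the `𝔻`-stable `Σ_α a_α z^α w^α` and `Σ_α (-1)^α b_{κ-α} (1+δ)^{|α|} z^α w^α` shows that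
`F(z,w)` is `𝔻`-stable or zero; it is not zero since `a_0 b_κ ≠ 0` (`f(0) ≠ 0`; `b_κ ≠ 0` by part I Lemma 6.1),
and `{f,g}_κ = κ! F((1+δ)^{-1/2},…)`. As in Theorem 5.6 we take `f ∈ ℂ_κ[z]`.

## Main results (namespace `Literature.Combinatorics.StablePolynomials`)

* `mvApolarForm κ f g` — the form `{f,g}_κ`; `mvApolarForm_def`.
* **`BorceaBranden_apolarity_disk`** — Lemma 5.5.

## References

* [BorceaBranden2009II] J. Borcea, P. Brändén, Comm. Pure Appl. Math. 62 (2009) 1595–1631, §5 (definition of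
  `{f,g}_κ`), Lemma 5.5, Thm. 5.6.
-/

noncomputable section

open MvPolynomial Finset

namespace Literature.Combinatorics.StablePolynomials

variable {τ : Type*} [Fintype τ] [DecidableEq τ]

/-! ## §1 The multivariate apolarity form -/

section Form

/-- **The multivariate apolarity form** `{f,g}_κ = Σ_{α ≤ κ} (-1)^{|α|} f^{(α)}(0) g^{(κ-α)}(0)`, with
`f^{(α)}(0) = α! a_α` for `f = Σ a_α z^α` (`α! = Π_i α_i!`). [cite: BorceaBranden2009II, §5 (definition of
`{f,g}_κ` before Lemma 5.3)] -/
def mvApolarForm (κ : τ → ℕ) (f g : MvPolynomial τ ℂ) : ℂ :=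
  ∑ α ∈ Fintype.piFinset (fun i => range (κ i + 1)),
    (-1 : ℂ) ^ (∑ i, α i) * (∏ i, (((α i).factorial * (κ i - α i).factorial : ℕ) : ℂ)) *
      coeff (toF α) f * coeff (toF (κ - α)) g

/-- Unfolding `mvApolarForm`. [cite: BorceaBranden2009II, §5] -/
theorem mvApolarForm_def (κ : τ → ℕ) (f g : MvPolynomial τ ℂ) :
    mvApolarForm κ f g = ∑ α ∈ Fintype.piFinset (fun i => range (κ i + 1)),
      (-1 : ℂ) ^ (∑ i, α i) * (∏ i, (((α i).factorial * (κ i - α i).factorial : ℕ) : ℂ)) *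
        coeff (toF α) f * coeff (toF (κ - α)) g :=
  rfl

/-- Evaluation over a degree box: `p(v) = Σ_{m ≤ β} a_m v^m` for `p ∈ ℂ_β[z]`.
[cite: BorceaBranden2009II, §5 proof of Lemma 5.5 (`f(z) = Σ_α a_α z^α`)] -/
theorem eval_eq_sum_box {β : τ → ℕ} {p : MvPolynomial τ ℂ} (hp : ∀ i, degreeOf i p ≤ β i) (v : τ → ℂ) :
    eval v p = ∑ m ∈ Fintype.piFinset (fun i => range (β i + 1)), coeff (toF m) p * ∏ i, v i ^ m i := by
  classical
  conv_lhs => rw [eq_sum_box hp]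
  rw [map_sum]
  refine Finset.sum_congr rfl fun m _ => ?_
  rw [smul_eval, map_prod]
  simp only [map_pow, eval_X]

end Form

/-! ## §2 Lemma 5.5 -/

section Main

/-- **Borcea–Brändén II, Lemma 5.5** (Theorem 5.6 for `C_i = 𝔻`). Let `f, g ∈ ℂ_κ[z_1,…,z_n]` with `g` of
degree `κ` (`deg_{z_i} g = κ_i`). If `f` is `𝔻`-stable and `g` is `(ℂ ∖ 𝔻)`-stable (no zeros with all
`|z_i| ≥ 1`) then `{f,g}_κ ≠ 0`. [cite: BorceaBranden2009II, §5 Lemma 5.5] -/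
theorem BorceaBranden_apolarity_disk {κ : τ → ℕ} {f g : MvPolynomial τ ℂ} (hf : ∀ i, degreeOf i f ≤ κ i)
    (hfs : IsDiskStable f) (hg : ∀ i, degreeOf i g = κ i)
    (hgs : ∀ z : τ → ℂ, (∀ i, 1 ≤ ‖z i‖) → eval z g ≠ 0) : mvApolarForm κ f g ≠ 0 := by
  -- the exponent `κ` as `degVec g`
  set κ' : τ →₀ ℕ := degVec g with hκ'def
  have hκ' : ∀ i, κ' i = κ i := fun i => by rw [hκ'def, degVec_apply, hg i]
  have hgfits : ∀ α ∈ g.support, α ≤ κ' := fun α hα => le_degVec (mem_support_iff.1 hα)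
  -- `h = I_κ(g)` is `𝔻̄`-stable (Cor. 1.7), hence stable on a slightly larger open polydisc of radius `ρ > 1`
  set h := invOp κ' g with hhdef
  have hh : ∀ z : τ → ℂ, (∀ i, ‖z i‖ ≤ 1) → eval z h ≠ 0 := fun z hz => invOp_closedDiskStable hgs z hz
  obtain ⟨ρ, hρ1, hρ⟩ := exists_gt_radius_of_closedPolydisc (f := h) 0 zero_le_one
    (fun z hz => hh z fun i => by simpa using hz i)
  have hρ0 : 0 < ρ := zero_lt_one.trans hρ1
  have hhdeg : ∀ i, degreeOf i h ≤ κ i := fun i =>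
    degreeOf_le_iff.2 fun γ hγ => (hκ' i) ▸ invOp_fits κ' g γ hγ i
  have hcoeffh : ∀ α ∈ Fintype.piFinset (fun i => range (κ i + 1)),
      coeff (toF α) h = coeff (toF (κ - α)) g := by
    intro α hα
    have hle : toF (κ - α) ≤ κ' := Finsupp.le_def.2 fun i => by
      rw [toF_apply, Pi.sub_apply, hκ']; exact Nat.sub_le _ _
    have hsub : κ' - toF (κ - α) = toF α := by
      ext i
      rw [Finsupp.tsub_apply, toF_apply, toF_apply, Pi.sub_apply, hκ',
        Nat.sub_sub_self (mem_box_iff.1 hα i)]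
    rw [← hsub, hhdef, coeff_invOp hgfits hle]
  -- the two non-zero corner coefficients
  have ha0 : coeff (toF (0 : τ → ℕ)) f ≠ 0 := by
    have h0 := hfs 0 fun i => by simp
    rwa [show eval (0 : τ → ℂ) f = coeff 0 f by
      rw [MvPolynomial.eval_zero]; exact congr_fun constantCoeff_eq f,
      show (0 : τ →₀ ℕ) = toF (0 : τ → ℕ) from (toF_coe 0).symm] at h0
  have hbκ : coeff (toF κ) g ≠ 0 := by
    have := coeff_degVec_ne_zero_of_exteriorDiskStable (f := g) fun z hz => hgs z fun i => (hz i).le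
    rwa [show degVec g = toF κ from Finsupp.ext fun i => by rw [← hκ'def, hκ', toF_apply]] at this
  -- the binomial weights and the data `P_α(w) = a_α w^α / binom(κ,α)`, `Q_α(z) = (-ρ)^{|α|} b_{κ-α} z^α / binom(κ,α)`
  set B : (τ → ℕ) → ℂ := fun α => ∏ i, (((κ i).choose (α i) : ℕ) : ℂ) with hBdef
  have hB : ∀ α ∈ Fintype.piFinset (fun i => range (κ i + 1)), B α ≠ 0 := fun α hα =>
    Finset.prod_ne_zero_iff.2 fun i _ => Nat.cast_ne_zero.2 (Nat.choose_pos (mem_box_iff.1 hα i)).ne'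
  set P : (τ → ℕ) → MvPolynomial τ ℂ := fun α => C (coeff (toF α) f / B α) * ∏ i, X i ^ α i with hPdef
  set Q : (τ → ℕ) → MvPolynomial τ ℂ :=
    fun α => C ((-(ρ : ℂ)) ^ (∑ i, α i) * coeff (toF (κ - α)) g / B α) * ∏ i, X i ^ α i with hQdef
  have hPeval : ∀ α (v : τ → ℂ), eval v (P α) = coeff (toF α) f / B α * ∏ i, v i ^ α i := fun α v => by
    rw [hPdef]
    simp only [map_mul, eval_C, map_prod, map_pow, eval_X]
  have hQeval : ∀ α (v : τ → ℂ), eval v (Q α) =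
      (-(ρ : ℂ)) ^ (∑ i, α i) * coeff (toF (κ - α)) g / B α * ∏ i, v i ^ α i := fun α v => by
    rw [hQdef]
    simp only [map_mul, eval_C, map_prod, map_pow, eval_X]
  -- `F(z,w) = f(zw)` is `𝔻`-stable
  have hF : IsDiskStable (mvCompositionF κ P) := by
    intro u hu
    have hv : ∀ i, ‖u (Sum.inl i) * u (Sum.inr i)‖ < 1 := fun i => by
      rw [norm_mul]
      exact mul_lt_one_of_nonneg_of_lt_one_left (norm_nonneg _) (hu _) (hu _).le
    have hval : eval u (mvCompositionF κ P) = eval (fun i => u (Sum.inl i) * u (Sum.inr i)) f := by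
      rw [mvCompositionF, map_sum, eval_eq_sum_box hf]
      refine Finset.sum_congr rfl fun α hα => ?_
      rw [smul_eval, map_mul, map_prod, eval_rename, hPeval]
      simp only [map_pow, eval_X, Function.comp_apply, mul_pow, Finset.prod_mul_distrib]
      have hBα := hB α hα
      field_simp
      ring
    rw [hval]
    exact hfs _ hv
  -- `G(z,w) = h(-ρ zw)` is `𝔻`-stable
  have hG : IsDiskStable (mvCompositionG κ Q) := by
    intro u hu
    have hv : ∀ i, ‖u (Sum.inl i) * u (Sum.inr i)‖ < 1 := fun i => by
      rw [norm_mul]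
      exact mul_lt_one_of_nonneg_of_lt_one_left (norm_nonneg _) (hu _) (hu _).le
    have hval : eval u (mvCompositionG κ Q) =
        eval (fun i => -(ρ : ℂ) * (u (Sum.inl i) * u (Sum.inr i))) h := by
      rw [mvCompositionG, map_sum, eval_eq_sum_box hhdeg]
      refine Finset.sum_congr rfl fun α hα => ?_
      rw [smul_eval, map_mul, map_prod, eval_rename, hQeval, hcoeffh α hα]
      simp only [map_pow, eval_X, Function.comp_apply, mul_pow, Finset.prod_mul_distrib,
        Finset.prod_pow_eq_pow_sum]
      have hBα := hB α hα
      field_simp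
      ring
    rw [hval]
    refine hρ _ fun i => ?_
    rw [sub_zero, norm_mul, norm_neg, Complex.norm_real, Real.norm_of_nonneg hρ0.le]
    calc ρ * ‖u (Sum.inl i) * u (Sum.inr i)‖ < ρ * 1 := mul_lt_mul_of_pos_left (hv i) hρ0
      _ = ρ := mul_one ρ
  -- the master composition theorem: `D = Σ_α (-1)^α a_α b_{κ-α} ρ^{|α|} z^α w^α / binom(κ,α)` is stable or zero
  rcases mv_master_composition_disk P Q hF hG with hD0 | hD
  · -- not zero: `D(0,0) = a_0 b_κ ≠ 0`
    have h0mem : (0 : τ → ℕ) ∈ Fintype.piFinset (fun i => range (κ i + 1)) :=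
      mem_box_iff.2 fun i => Nat.zero_le _
    have hval : eval (0 : τ ⊕ τ → ℂ) (mvCompositionD κ P Q) = coeff (toF κ) g * coeff (toF (0 : τ → ℕ)) f := by
      rw [mvCompositionD, map_sum, Finset.sum_eq_single_of_mem (0 : τ → ℕ) h0mem fun α hα hne => by
        obtain ⟨i, hi⟩ : ∃ i, α i ≠ 0 := by
          by_contra hcon
          push Not at hcon
          exact hne (funext hcon)
        have hz : (∏ j, ((0 : τ ⊕ τ → ℂ) ∘ Sum.inr) j ^ α j) = 0 :=
          Finset.prod_eq_zero (Finset.mem_univ i) (by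
            simp only [Function.comp_apply, Pi.zero_apply]
            exact zero_pow hi)
        rw [smul_eval, map_mul, eval_rename, eval_rename, hPeval, hz, mul_zero, mul_zero, mul_zero]]
      rw [smul_eval, map_mul, eval_rename, eval_rename, hPeval, hQeval]
      have hB0 : B 0 = 1 := by
        rw [hBdef]
        exact Finset.prod_eq_one fun i _ => by rw [Pi.zero_apply, Nat.choose_zero_right, Nat.cast_one]
      have hκ0 : κ - 0 = κ := funext fun i => Nat.sub_zero _
      simp only [Pi.zero_apply, pow_zero, Finset.prod_const_one, Finset.sum_const_zero, hB0, hκ0,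
        Nat.choose_zero_right, Nat.cast_one, mul_one, div_one, one_mul]
    rw [hD0, map_zero] at hval
    exact absurd hval.symm (mul_ne_zero hbκ ha0)
  · -- stable: evaluate at the point `z_i = w_i = ρ^{-1/2} ∈ 𝔻`
    set t : ℝ := (Real.sqrt ρ)⁻¹ with htdef
    have hsqrt : 1 < Real.sqrt ρ := by
      rw [← Real.sqrt_one]
      exact Real.sqrt_lt_sqrt zero_le_one hρ1
    have ht1 : ‖(t : ℂ)‖ < 1 := by
      rw [Complex.norm_real, Real.norm_of_nonneg (by positivity), htdef]
      exact inv_lt_one_of_one_lt₀ hsqrt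
    have hρt : (ρ : ℂ) * t * t = 1 := by
      have : ρ * t * t = 1 := by
        rw [htdef, mul_assoc, ← mul_inv, Real.mul_self_sqrt hρ0.le, mul_inv_cancel₀ hρ0.ne']
      exact_mod_cast this
    have hne := hD (fun _ => (t : ℂ)) fun _ => ht1
    have hval : eval (fun _ : τ ⊕ τ => (t : ℂ)) (mvCompositionD κ P Q) =
        ∑ α ∈ Fintype.piFinset (fun i => range (κ i + 1)),
          (-1 : ℂ) ^ (∑ i, α i) * coeff (toF α) f * coeff (toF (κ - α)) g / B α := by
      rw [mvCompositionD, map_sum]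
      refine Finset.sum_congr rfl fun α hα => ?_
      rw [smul_eval, map_mul, eval_rename, eval_rename, hPeval, hQeval]
      simp only [Function.comp_apply, Finset.prod_pow_eq_pow_sum]
      have hBα := hB α hα
      rw [show (-(ρ : ℂ)) ^ (∑ i, α i) = (-1 : ℂ) ^ (∑ i, α i) * (ρ : ℂ) ^ (∑ i, α i) by
        rw [← mul_pow, neg_one_mul]]
      have key : (ρ : ℂ) ^ (∑ i, α i) * (t : ℂ) ^ (∑ i, α i) * (t : ℂ) ^ (∑ i, α i) = 1 := by
        rw [← mul_pow, ← mul_pow, hρt, one_pow]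
      calc B α * ((-1 : ℂ) ^ (∑ i, α i) * (ρ : ℂ) ^ (∑ i, α i) * coeff (toF (κ - α)) g / B α *
              (t : ℂ) ^ (∑ i, α i) * (coeff (toF α) f / B α * (t : ℂ) ^ (∑ i, α i)))
          = (-1 : ℂ) ^ (∑ i, α i) * coeff (toF α) f * coeff (toF (κ - α)) g / B α *
              ((ρ : ℂ) ^ (∑ i, α i) * (t : ℂ) ^ (∑ i, α i) * (t : ℂ) ^ (∑ i, α i)) * (B α / B α) := by
            ring
        _ = _ := by rw [key, div_self hBα, mul_one, mul_one]
    -- `{f,g}_κ = κ! · D(t,…,t)`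
    have hform : mvApolarForm κ f g =
        (∏ i, ((κ i).factorial : ℂ)) * eval (fun _ : τ ⊕ τ => (t : ℂ)) (mvCompositionD κ P Q) := by
      rw [hval, mvApolarForm, Finset.mul_sum]
      refine Finset.sum_congr rfl fun α hα => ?_
      have hBα := hB α hα
      have hKF : (∏ i, ((κ i).factorial : ℂ)) =
          B α * ∏ i, (((α i).factorial * (κ i - α i).factorial : ℕ) : ℂ) := by
        rw [hBdef, ← Finset.prod_mul_distrib]
        refine Finset.prod_congr rfl fun i _ => ?_
        rw [← Nat.cast_mul, ← mul_assoc, Nat.choose_mul_factorial_mul_factorial (mem_box_iff.1 hα i)]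
      rw [hKF]
      field_simp
    rw [hform]
    exact mul_ne_zero (Finset.prod_ne_zero_iff.2 fun i _ => Nat.cast_ne_zero.2 (Nat.factorial_ne_zero _)) hne

end Main

end Literature.Combinatorics.StablePolynomials

end
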